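import Mathlib
import HarnessLib

/-!
# LAST-CENTRE CALCULUS — DEFINITIONS: stages, coordinate centres, the blow-up chart map, drop points, residuals of the discriminant,
# the cone-initial axis order, the toric budget scheme, and two canonicity predicates
# (crux `FInjectiveMacaulayfication` stmt-ResolutionOfSingularities-15315, chain w45a; res-L1-w45a-plan-1 RULING R25.31 (4) «(LC)/(LP) typed»; seat res-L1-w45a-lead-1 g16)

[OURS · L1 W4.5a] Support file (`--supports stmt-ResolutionOfSingularities-15315 --as helper`); replaces the role of NO printed item; NOT a statement of any
manuscript; DEFINITIONS ONLY (no theorem, no instance, no notation, no named fact). Companion theorem file: `…FullLastCentreAxisOrder` (K10: the chart map is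
the blow-up substitution, the discriminant transport `σ_L(Disc P) = y_L⁶·Disc P′`, and the reduction `ρ′ ≤` cone-initial axis order). The typed CONJECTURES built on
these definitions ((LC), (LP), the one-centre door) live in the crux workfile `Cruxes/FInjectiveMacaulayfication/Lines/T_canon_door.lean`, not here.
AI-written (AI review is weaker than expert review).

THE UNIVERSE (the chain engines' universe of `Cruxes/…/Lines/T-disc.md`, stated without truncation). A STAGE is a monic cubic `P = x³ + b₂x² + b₁x + b₀`,
`bᵢ ∈ k[y₁,…,y₄]` (letters `Fin 4` = the four non-Weierstrass chart coordinates at a chart origin; `x` is never a blow-up direction), with the set `Exc` of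
EXCEPTIONAL letters through the point and their SIGNED DEFECTS `d` (`d_E = a_E − e_E`: log discrepancy minus the exponent removed by the controlled transform).
A CENTRE is a COORDINATE subspace `Z = V(x, y_n : n ∈ Nor)` (point `|Nor| = 4`, curve 3, surface 2, threefold 1); `Permissible` = normal flatness of
multiplicity 3 (`bᵢ ∈ I_Z^{3−i}`). The blow-up of `Z` in the `y_L`-chart is the monomial substitution `chartMap Nor L = σ_L : y_n ↦ y_n·y_L (n ∈ Nor ∖ L)`,
realised as the ring endomorphism induced by the additive exponent map `tau`; `IsChart S Nor L S′` records the controlled transform `σ_L(bᵢ) = y_L^{3−i}bᵢ′`,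
`Exc′ = Exc ∪ {L}` and the defect of the new divisor `d′_L = (codim Z − 4) + Σ_{E ⊃ Z} d_E`. `IsDropPoint`: `b₂(0) ≠ 0`, `b₁(0) = 0`, `ord b₀ ≥ 2` (multiplicity 2;
all orders are then read on `Disc_x P`, exact by the master formula `Disc_x P = −4a″·unit`). `IsResidual Exc D α N`: `D = y^α·N`, `α` on `Exc`, `N` prime to the
exceptional letters (`ρ = ord₀ N`). `AxisOrdLE Nor L N m`: some monomial of `N` of MINIMAL normal degree `ν` has `|e| − e_L ≤ m` (for `ν = 0`: `ord_x(N|_Z) ≤ m`).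
`Budgeted`: the toric budget scheme `v_w(P) ≤ w_x + Σ_n w_n + Σ_{n∈Exc} d_n w_n` for every weight (K4 `FullWeightBudget.le_sum_weights_of_survivor` transported
along a letter chain). `CoordCanonical` (the sweeps' `canon_coord`) and `TopLocusIs` (ideal-theoretic «`Sing₃(X) = Z` near the origin», regular-top-locus case).
-/

-- single-problem summit: the doubled namespace component is forced
set_option linter.dupNamespace false

noncomputable section

open MvPolynomial Finsupp

namespace Summit.ResolutionOfSingularities.ResolutionOfSingularities.Theorems.FInjectiveMacaulayfication.LastCentreDefs

/-- The four non-Weierstrass letters at a chart origin. [OURS · L1 W4.5a · definition; folklore] -/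
abbrev Letter : Type := Fin 4

/-- Exponent vectors of monomials in the four letters. [OURS · L1 W4.5a · definition; folklore] -/
abbrev Expo : Type := Letter →₀ ℕ

variable (k : Type) [Field k]

/-- Polynomials in the four letters `y₁,…,y₄` over `k`. [OURS · L1 W4.5a · definition; folklore] -/
abbrev YPoly : Type := MvPolynomial Letter k

variable {k}

/-- Total degree `|e| = Σ_n e_n` of an exponent vector (order at the chart origin of the monomial `y^e`). [OURS · L1 W4.5a · definition; folklore] -/
def tdeg (e : Expo) : ℕ := ∑ n : Letter, e n

/-- Normal degree `Σ_{n ∈ Nor} e_n` of `y^e` along the coordinate centre `Z = V(x, y_n : n ∈ Nor)` (its order at the generic point of `Z`). [OURS · L1 W4.5a · definition; folklore] -/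
def norDeg (Nor : Finset Letter) (e : Expo) : ℕ := ∑ n ∈ Nor, e n

/-- The discriminant of the monic cubic `x³ + b₂x² + b₁x + b₀`: `b₂²b₁² − 4b₁³ − 4b₂³b₀ − 27b₀² + 18b₂b₁b₀`. [OURS · L1 W4.5a · definition; folklore] -/
def disc (b₂ b₁ b₀ : YPoly k) : YPoly k :=
  b₂ ^ 2 * b₁ ^ 2 - 4 * b₁ ^ 3 - 4 * b₂ ^ 3 * b₀ - 27 * b₀ ^ 2 + 18 * b₂ * b₁ * b₀

/-- The exponent map of the `y_L`-chart of the blow-up along `Z = V(x, y_n : n ∈ Nor)`: `e ↦ e + (Σ_{n ∈ Nor, n ≠ L} e_n)·ε_L`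
(`y_n = y_n′·y_L` for the other normal letters). Additive. [OURS · L1 W4.5a · definition; folklore] -/
def tau (Nor : Finset Letter) (L : Letter) : Expo →+ Expo where
  toFun e := e + Finsupp.single L (norDeg (Nor.erase L) e)
  map_zero' := by simp [norDeg]
  map_add' a b := by
    simp only [norDeg, Finsupp.coe_add, Pi.add_apply, Finset.sum_add_distrib, Finsupp.single_add]
    abel

/-- The chart map `σ_L` of the blow-up along `Z = V(x, y_n : n ∈ Nor)` in the `y_L`-chart, on `k[y₁,…,y₄]`: the ring endomorphism induced by `tau`
(`y_n ↦ y_n·y_L` for `n ∈ Nor ∖ {L}`, every other letter fixed — `chartMap_X`). [OURS · L1 W4.5a · definition; folklore] -/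
def chartMap (Nor : Finset Letter) (L : Letter) : YPoly k →+* YPoly k :=
  AddMonoidAlgebra.mapDomainRingHom k (tau Nor L)

/-- A STAGE: the monic cubic `x³ + b₂x² + b₁x + b₀` at a chart origin, the exceptional letters through it, and their signed defects. [OURS · L1 W4.5a · definition; folklore] -/
structure Stage (k : Type) [Field k] where
  /-- coefficient of `x²` -/
  b₂ : YPoly k
  /-- coefficient of `x` -/
  b₁ : YPoly k
  /-- constant coefficient -/
  b₀ : YPoly k
  /-- exceptional letters through the point -/
  Exc : Finset Letter
  /-- signed defects `d_E = a_E − e_E` of the exceptional letters (value irrelevant off `Exc`) -/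
  d : Letter → ℤ

/-- The discriminant `Disc_x P` of a stage. [OURS · L1 W4.5a · definition; folklore] -/
def Stage.D (S : Stage k) : YPoly k := disc S.b₂ S.b₁ S.b₀

/-- PERMISSIBILITY of the centre `Z = V(x, y_n : n ∈ Nor)`: `X` is normally flat of multiplicity 3 along `Z`, i.e. `bᵢ ∈ I_Z^{3−i}`:
every monomial of `b₂` (resp. `b₁`, `b₀`) has normal degree `≥ 1` (resp. `≥ 2`, `≥ 3`). [OURS · L1 W4.5a · definition; folklore] -/
def Permissible (S : Stage k) (Nor : Finset Letter) : Prop :=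
  (∀ e ∈ S.b₂.support, 1 ≤ norDeg Nor e) ∧ (∀ e ∈ S.b₁.support, 2 ≤ norDeg Nor e) ∧ (∀ e ∈ S.b₀.support, 3 ≤ norDeg Nor e)

/-- `S′` IS THE `y_L`-CHART ORIGIN STAGE of the blow-up of `S` along `Z = V(x, y_n : n ∈ Nor)`: controlled transform `σ_L(bᵢ) = y_L^{3−i}·bᵢ′`,
exceptional letters `Exc′ = Exc ∪ {L}`, defects unchanged except `d′_L = (codim Z − 4) + Σ_{E ⊃ Z} d_E = (|Nor| + 1 − 4) + Σ_{n ∈ Exc ∩ Nor} d_n`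
(`T-disc` §0.24 (a)). [OURS · L1 W4.5a · definition; folklore] -/
def IsChart (S : Stage k) (Nor : Finset Letter) (L : Letter) (S' : Stage k) : Prop :=
  chartMap Nor L S.b₂ = X L * S'.b₂ ∧ chartMap Nor L S.b₁ = X L ^ 2 * S'.b₁ ∧ chartMap Nor L S.b₀ = X L ^ 3 * S'.b₀ ∧
    S'.Exc = insert L S.Exc ∧ (∀ n, n ≠ L → S'.d n = S.d n) ∧
    S'.d L = ((Nor.card : ℤ) + 1 - 4) + ∑ n ∈ S.Exc ∩ Nor, S.d n

/-- DROP POINT at the chart origin: `b₂(0) ≠ 0`, `b₁(0) = 0`, `ord b₀ ≥ 2` — the multiplicity has dropped from 3 to 2 (the engines' `F₂` unit,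
`ord F₁ ≥ 1`, `ord F₀ ≥ 2`). [OURS · L1 W4.5a · definition; folklore] -/
def IsDropPoint (S : Stage k) : Prop :=
  coeff 0 S.b₂ ≠ 0 ∧ coeff 0 S.b₁ = 0 ∧ ∀ e ∈ S.b₀.support, 2 ≤ tdeg e

/-- `D = y^α · N` IS THE RESIDUAL DECOMPOSITION w.r.t. the exceptional letters `Exc`: `α` is supported on `Exc` and `N` is prime to every exceptional
letter (for each `n ∈ Exc` some monomial of `N` has `e_n = 0`). Then `ord₀ N` is the residual order `ρ` («ord N»). [OURS · L1 W4.5a · definition; folklore] -/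
def IsResidual (Exc : Finset Letter) (D : YPoly k) (α : Expo) (N : YPoly k) : Prop :=
  D = monomial α 1 * N ∧ (∀ n, n ∉ Exc → α n = 0) ∧ ∀ n ∈ Exc, ∃ e ∈ N.support, e n = 0

/-- `ord₀ G ≤ m`: some monomial of `G` has total degree `≤ m`. [OURS · L1 W4.5a · definition; folklore] -/
def OrdLE (G : YPoly k) (m : ℕ) : Prop :=
  ∃ e ∈ G.support, tdeg e ≤ m

/-- THE CONE-INITIAL PART OF `N` ALONG `Z`, READ AT THE `y_L`-CHART ORIGIN, HAS ORDER `≤ m`: some monomial `y^e` of `N` of MINIMAL normal degree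
`ν` has `|e| − e_L ≤ m`. For `ν = 0`: `ord_x(N|_Z) ≤ m`; for `ν ≥ 1` it is implied by `ord_x([L^ν]N) ≤ m` (pure-direction coefficient, `T-disc` §0.24 (c));
for a point centre (`Nor = univ`): the image of `x′` in `E ≅ ℙ³` is a point of multiplicity `≤ m` of `{in_x N = 0}`. [OURS · L1 W4.5a · definition; folklore] -/
def AxisOrdLE (Nor : Finset Letter) (L : Letter) (N : YPoly k) (m : ℕ) : Prop :=
  ∃ e ∈ N.support, (∀ e₁ ∈ N.support, norDeg Nor e ≤ norDeg Nor e₁) ∧ tdeg e ≤ m + e L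

/-- THE F-CONTENT (toric budget scheme): for every weight `w = (w_x; w_y)` the weighted order of `P = x³ + b₂x² + b₁x + b₀` is at most
`w_x + Σ_n w_n + Σ_{n ∈ Exc} d_n·w_n` — K4 `le_sum_weights_of_survivor` (F-purity at `x₀` ⇒ `v(f) ≤ A(v)` for every monomial valuation) transported
along the chain (`A_{W_j}(v) = A_{W₀}(v) − Σ a_E v(E)`, `P_j = π^*f / Π E^{e_E}`). Stated as: some monomial of `P` has weight `≤` the bound. [OURS · L1 W4.5a · definition; folklore] -/
def Budgeted (S : Stage k) : Prop :=
  ∀ (wx : ℕ) (w : Letter → ℕ),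
    (3 * (wx : ℤ) ≤ wx + ∑ n, (w n : ℤ) + ∑ n ∈ S.Exc, S.d n * w n) ∨
      ∃ i : Fin 3, ∃ e ∈ (![S.b₀, S.b₁, S.b₂] i).support,
        ((i : ℕ) * (wx : ℤ) + ∑ n, (w n * e n : ℤ)) ≤ wx + ∑ n, (w n : ℤ) + ∑ n ∈ S.Exc, S.d n * w n

/-- COORDINATE CANONICITY of the centre `Z = V(x, y_n : n ∈ Nor)` (the sweeps' `canon_coord`, a NECESSARY condition for canonicity): no coordinate
subspace `V(x, y_n : n ∈ Nor ∖ {n₀}) ⊋ Z` lies in the multiplicity-3 locus, i.e. for no `n₀ ∈ Nor` (with `Nor ∖ {n₀} ≠ ∅`) is `X` normally flat of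
multiplicity 3 along the larger subspace. [OURS · L1 W4.5a · definition; folklore] -/
def CoordCanonical (S : Stage k) (Nor : Finset Letter) : Prop :=
  ∀ n₀ ∈ Nor, (Nor.erase n₀).Nonempty → ¬ Permissible S (Nor.erase n₀)

/-- The cubic `P = x³ + b₂x² + b₁x + b₀` as a polynomial in FIVE letters (`none` = `x`, `some n` = `y_n`). [OURS · L1 W4.5a · definition; folklore] -/
def Stage.P (S : Stage k) : MvPolynomial (Option Letter) k :=
  X none ^ 3 + rename Option.some S.b₂ * X none ^ 2 + rename Option.some S.b₁ * X none + rename Option.some S.b₀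

/-- The order-`≤ 2` JACOBIAN-TYPE IDEAL `J₃(P) = (P, ∂P, ∂²P)` of the cubic in `k[x, y₁, …, y₄]` (usual partial derivatives; for `char k ≥ 5` its zero set is
the multiplicity-`≥ 3` locus `Sing₃(X)`; in characteristics 2, 3 Hasse derivatives would be needed — outside the `p ≥ 7` regime of the T-side). [OURS · L1 W4.5a · definition; folklore] -/
def Stage.J₃ (S : Stage k) : Ideal (MvPolynomial (Option Letter) k) :=
  Ideal.span ({S.P} ∪ Set.range (fun i => pderiv i S.P) ∪ Set.range (fun ij : Option Letter × Option Letter => pderiv ij.1 (pderiv ij.2 S.P)))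

/-- IDEAL-THEORETIC CANONICITY «`Sing₃(X) = Z` near `x`» (the REGULAR-top-locus case of the rule of record R25.26 (b)): `J₃(P) ⊆ I_Z = (x, y_n : n ∈ Nor)`
and, locally at the origin, `I_Z ⊆ √J₃(P)`: some `g` with `g(0) ≠ 0` and some `M` with `g·x^M ∈ J₃` and `g·y_n^M ∈ J₃` for all `n ∈ Nor`.
-- TODO(general form): the singular-top-locus recursion («else recurse on Sing(T₀)») of R25.26 (b) is not typed here. [OURS · L1 W4.5a · definition; folklore] -/
def TopLocusIs (S : Stage k) (Nor : Finset Letter) : Prop :=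
  S.J₃ ≤ Ideal.span ({X none} ∪ ((fun n => X (Option.some n)) '' (Nor : Set Letter))) ∧
    ∃ g : MvPolynomial (Option Letter) k, eval (fun _ => (0 : k)) g ≠ 0 ∧ ∃ M : ℕ,
      g * X none ^ M ∈ S.J₃ ∧ ∀ n ∈ Nor, g * X (Option.some n) ^ M ∈ S.J₃

end Summit.ResolutionOfSingularities.ResolutionOfSingularities.Theorems.FInjectiveMacaulayfication.LastCentreDefs

end
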